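import Literature.MathematicalPhysics.KineticTheory.LangevinChainGibbs
import Literature.MathematicalPhysics.KineticTheory.LangevinChainNESSProofs
import Literature.MathematicalPhysics.KineticTheory.PhaseSpacePoisson
import HarnessLib

/-!
# Crux `ExtensiveSnapshotIrreversibility` (stmt-AtomisticToContinuum-9121), line `clausius-budget-sound-window`:
stub `stub_gibbsContactCalculus`

Registered stub of the lead's checked skeleton `Cruxes/ExtensiveSnapshotIrreversibility/Lines/clausius-budget-sound-window.lean`
(namespace `…Cruxes.ExtensiveSnapshotIrreversibility.ClausiusBudgetSoundWindow`), proved verbatim (name + signature) so that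
`ledger propose --supports stmt-AtomisticToContinuum-9121` accepts it. See the skeleton's module docstring for the line and the
`let`-dictionary (`μT, g, Pg, k, w, Pw`).

## Content: the static contact calculus of the equilibrium Gibbs state

For an oscillator chain `P` with `C¹` potentials, temperature `T ≠ 0`, Gibbs density
`ρ = e^{-H/T}` and the equilibrium generator `L = L_{T,T}` (both baths at `T`), and a test function
`f ∈ C²_c` (resp. `C¹_c`):

* `integral_mul_liouville_mul_gibbsDensity`: the Liouville part is antisymmetric,
  `∫ f (p_i ∂_{q_i} f - ∂_{q_i}H ∂_{p_i} f) ρ = 0` (apply the tree's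
  `integral_liouville_mul_gibbsDensity` to `f²` and the Leibniz rule `partialQ_mul`/`partialP_mul`);
* `integral_mul_bath_mul_gibbsDensity`: each Ornstein–Uhlenbeck bath is a negative Dirichlet form,
  `∫ f (T ∂²_{p_i} f - p_i ∂_{p_i} f) ρ = -T ∫ (∂_{p_i} f)² ρ` (one integration by parts in `p_i`,
  `∂_{p_i} ρ = -(p_i/T) ρ`);
* `integral_mul_generator_mul_gibbsDensity` / `integral_mul_generator_gibbsMeasure`: summing,
  `∫ f (L f) dμ_T = -γ T ∑_i (1[i=0] + 1[i=N-1]) ∫ (∂_{p_i} f)² dμ_T`;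
* `integral_sq_sub_mul_mul_gibbsDensity` / `integral_sq_sub_mul_gibbsMeasure`: Gaussian integration
  by parts in a momentum, `∫ (p_i² - T) f dμ_T = T ∫ p_i ∂_{p_i} f dμ_T`;
* `stub_gibbsContactCalculus`: the registered conjunction for `pinnedChain ω₂ lam β γ`, `T > 0`,
  `f ∈ C_c^∞`.

Everything is proved from the tree (`LangevinChainGibbs.lean`: `integral_mul_eq_neg_of_hasLineDerivAt`,
`hasLineDerivAt_gibbsDensity`, `integral_liouville_mul_gibbsDensity`, `integral_gibbsMeasure`;
`LangevinChainNESSProofs.lean`: calculus of `partialP/partialQ`; `PhaseSpacePoisson.lean`: Leibniz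
rules); no named fact is used. Sources: Cuneo–Eckmann–Hairer–Rey-Bellet 2018, §3.1 (proof of
Prop. 3.3: `L_{T,T}` is `-∑_b γ T ∂_{p_b}^* ∂_{p_b}` plus an antisymmetric part in `L²(μ_T)`);
Bonetto–Lebowitz–Rey-Bellet 2000, §4.1.
-/

noncomputable section

namespace Summit.AtomisticToContinuum.FouriersLaw.Theorems.ExtensiveSnapshotIrreversibility.ClausiusBudget

open MeasureTheory Filter Topology
open scoped ENNReal NNReal
open Literature.MathematicalPhysics.KineticTheory.HeatConduction

variable {N : ℕ}

/-! ### Calculus along a momentum direction -/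

/-- The momentum coordinate `p_i` has line derivative `1` along the direction `(0, e_i)` of phase
space: `d/dt (p + t e_i)_i = 1`. [folklore] -/
theorem hasLineDerivAt_momentum_unitP (x : PhaseSpace N) (i : Fin N) :
    HasLineDerivAt ℝ (fun y : PhaseSpace N => y.2 i) 1 x ((0, Pi.single i 1) : PhaseSpace N) := by
  unfold HasLineDerivAt
  simp only [add_smul_unitP_snd, add_smul_single_eq_update, Function.update_self]
  exact (hasDerivAt_id' (0 : ℝ)).const_add (x.2 i)

/-! ### Gaussian integration by parts in a momentum -/

/-- **Gaussian integration by parts against `e^{-H/T}`** (density level). For a chain with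
continuous potentials, `T ≠ 0`, `f ∈ C¹_c` and every site `i`:
`∫ (p_i² - T) f e^{-H/T} dq dp = T ∫ p_i ∂_{p_i} f e^{-H/T} dq dp`.
Proof: integrate by parts along `(0, e_i)` with `F = p_i e^{-H/T}`, whose line derivative is
`(1 - p_i²/T) e^{-H/T}` (`∂_{p_i} H = p_i`), against `g = f`:
`∫ p_i ρ ∂_{p_i} f = -∫ (1 - p_i²/T) ρ f`. [Cuneo–Eckmann–Hairer–Rey-Bellet 2018, §3.1]
[folklore] -/
theorem integral_sq_sub_mul_mul_gibbsDensity (P : OscillatorChain) (hU : Continuous P.U)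
    (hV : Continuous P.V) (N : ℕ) {T : ℝ} (hT : T ≠ 0) {f : PhaseSpace N → ℝ}
    (hf : ContDiff ℝ 1 f) (hfc : HasCompactSupport f) (i : Fin N) :
    ∫ x, (x.2 i ^ 2 - T) * f x * P.gibbsDensity N T x =
      T * ∫ x, x.2 i * partialP i f x * P.gibbsDensity N T x := by
  have hfd : Differentiable ℝ f := hf.differentiable one_ne_zero
  have hρc : Continuous (P.gibbsDensity N T) := P.continuous_gibbsDensity hU hV N T
  have hPc : Continuous (partialP i f) := continuous_partialP hf one_ne_zero i
  -- integration by parts: `∫ (p_i ρ) ∂_{p_i} f = -∫ ∂_{p_i}(p_i ρ) f`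
  have e : ∫ x, (x.2 i * P.gibbsDensity N T x) * partialP i f x =
      -∫ x, (1 * P.gibbsDensity N T x + x.2 i * (-(x.2 i / T) * P.gibbsDensity N T x)) * f x := by
    apply integral_mul_eq_neg_of_hasLineDerivAt (v := ((0, Pi.single i 1) : PhaseSpace N))
      (by fun_prop) (by fun_prop) hf.continuous hPc hfc (hasCompactSupport_partialP hfd hfc i)
    · intro x
      have h1 := hasLineDerivAt_momentum_unitP x i
      have h2 := P.hasLineDerivAt_gibbsDensity (T := T) (P.hasLineDerivAt_hamiltonian_unitP N x i)
      unfold HasLineDerivAt at h1 h2 ⊢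
      have h := h1.fun_mul h2
      simp only [zero_smul, add_zero] at h
      exact h
    · exact fun x => hasLineDerivAt_partialP hfd i x
  have h1 : (fun x => x.2 i * partialP i f x * P.gibbsDensity N T x) =
      fun x => (x.2 i * P.gibbsDensity N T x) * partialP i f x := by
    funext x; ring
  have h2 : (fun x => (1 * P.gibbsDensity N T x + x.2 i * (-(x.2 i / T) * P.gibbsDensity N T x)) *
      f x) = fun x => -T⁻¹ * ((x.2 i ^ 2 - T) * f x * P.gibbsDensity N T x) := by
    funext x; field_simp; ring
  rw [h1, e, h2, integral_const_mul, neg_mul, neg_neg, ← mul_assoc, mul_inv_cancel₀ hT, one_mul]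

/-- **Gaussian integration by parts in the Gibbs state** (measure level): for a chain with
continuous potentials, `T ≠ 0`, `f ∈ C¹_c` and every site `i`,
`∫ (p_i² - T) f dμ_T = T ∫ p_i ∂_{p_i} f dμ_T`, `μ_T = Z⁻¹ e^{-H/T} dq dp` the Gibbs measure
(both sides are `(∫ρ)⁻¹` times the density-level identity, `integral_gibbsMeasure`).
[Cuneo–Eckmann–Hairer–Rey-Bellet 2018, §3.1] [folklore] -/
theorem integral_sq_sub_mul_gibbsMeasure (P : OscillatorChain) (hU : Continuous P.U)
    (hV : Continuous P.V) (N : ℕ) {T : ℝ} (hT : T ≠ 0) {f : PhaseSpace N → ℝ}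
    (hf : ContDiff ℝ 1 f) (hfc : HasCompactSupport f) (i : Fin N) :
    ∫ x, (x.2 i ^ 2 - T) * f x ∂(P.gibbsMeasure N T) =
      T * ∫ x, x.2 i * partialP i f x ∂(P.gibbsMeasure N T) := by
  simp only [P.integral_gibbsMeasure]
  rw [integral_sq_sub_mul_mul_gibbsDensity P hU hV N hT hf hfc i]
  ring

/-! ### The Dirichlet form of the equilibrium generator -/

/-- **The Liouville part is antisymmetric in `L²(e^{-H/T})`** (density level). For `C¹`
potentials, `f ∈ C¹_c` and every site `i`:
`∫ f (p_i ∂_{q_i} f - ∂_{q_i}H ∂_{p_i} f) e^{-H/T} dq dp = 0`.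
Proof: the Hamiltonian vector field `X_H` preserves `e^{-H/T} dq dp` weakly
(`integral_liouville_mul_gibbsDensity`, applied to `f² ∈ C¹_c`) and `X_H (f²) = 2 f X_H f`
(Leibniz rule for `partialQ`, `partialP`). [Cuneo–Eckmann–Hairer–Rey-Bellet 2018, §3.1, proof of
Prop. 3.3] [folklore] -/
theorem integral_mul_liouville_mul_gibbsDensity (P : OscillatorChain) (hU : ContDiff ℝ 1 P.U)
    (hV : ContDiff ℝ 1 P.V) (N : ℕ) (T : ℝ) {f : PhaseSpace N → ℝ} (hf : ContDiff ℝ 1 f)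
    (hfc : HasCompactSupport f) (i : Fin N) :
    ∫ x, f x * (x.2 i * partialQ i f x - partialQ i (P.hamiltonian N) x * partialP i f x) *
      P.gibbsDensity N T x = 0 := by
  have hfd : Differentiable ℝ f := hf.differentiable one_ne_zero
  have h := P.integral_liouville_mul_gibbsDensity hU hV N T (f := f * f) (hf.mul hf)
    hfc.mul_right i
  simp only [partialQ_mul hfd hfd, partialP_mul hfd hfd] at h
  have e : (fun x => (x.2 i * (f x * partialQ i f x + f x * partialQ i f x) -
      partialQ i (P.hamiltonian N) x * (f x * partialP i f x + f x * partialP i f x)) *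
        P.gibbsDensity N T x) = fun x => 2 * (f x * (x.2 i * partialQ i f x -
          partialQ i (P.hamiltonian N) x * partialP i f x) * P.gibbsDensity N T x) := by
    funext x; ring
  rw [e, integral_const_mul] at h
  linarith

/-- **Each Langevin bath is a negative Dirichlet form in `L²(e^{-H/T})`** (density level). For `C¹`
potentials, `T ≠ 0`, `f ∈ C²_c` and a bath at the SAME temperature `T` acting on `p_i`:
`∫ f (T ∂²_{p_i} f - p_i ∂_{p_i} f) e^{-H/T} dq dp = -T ∫ (∂_{p_i} f)² e^{-H/T} dq dp`.
Proof: one integration by parts along `(0, e_i)` with `F = f e^{-H/T}`,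
`∂_{p_i} F = (∂_{p_i} f - f p_i/T) e^{-H/T}`, against `g = ∂_{p_i} f`:
`T ∫ f ρ ∂²_{p_i} f = -T ∫ (∂_{p_i} f)² ρ + ∫ p_i f ∂_{p_i} f ρ`.
[Cuneo–Eckmann–Hairer–Rey-Bellet 2018, §3.1, proof of Prop. 3.3] [folklore] -/
theorem integral_mul_bath_mul_gibbsDensity (P : OscillatorChain) (hU : ContDiff ℝ 1 P.U)
    (hV : ContDiff ℝ 1 P.V) (N : ℕ) {T : ℝ} (hT : T ≠ 0) {f : PhaseSpace N → ℝ}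
    (hf : ContDiff ℝ 2 f) (hfc : HasCompactSupport f) (i : Fin N) :
    ∫ x, f x * (T * partialP i (partialP i f) x - x.2 i * partialP i f x) * P.gibbsDensity N T x =
      -T * ∫ x, (partialP i f x) ^ 2 * P.gibbsDensity N T x := by
  have hfd : Differentiable ℝ f := hf.differentiable two_ne_zero
  have hg : ContDiff ℝ 1 (partialP i f) := contDiff_partialP hf (by norm_num) i
  have hgd : Differentiable ℝ (partialP i f) := hg.differentiable one_ne_zero
  have hgc : HasCompactSupport (partialP i f) := hasCompactSupport_partialP hfd hfc i
  have hg'c : HasCompactSupport (partialP i (partialP i f)) := hasCompactSupport_partialP hgd hgc i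
  have hgC : Continuous (partialP i f) := hg.continuous
  have hg'C : Continuous (partialP i (partialP i f)) := continuous_partialP hg one_ne_zero i
  have hfC : Continuous f := hf.continuous
  have hρc : Continuous (P.gibbsDensity N T) :=
    P.continuous_gibbsDensity hU.continuous hV.continuous N T
  -- integration by parts: `∫ (f ρ) ∂²_{p_i} f = -∫ ∂_{p_i}(f ρ) ∂_{p_i} f`
  have e : ∫ x, (f x * P.gibbsDensity N T x) * partialP i (partialP i f) x =
      -∫ x, (partialP i f x * P.gibbsDensity N T x +
        f x * (-(x.2 i / T) * P.gibbsDensity N T x)) * partialP i f x := by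
    apply integral_mul_eq_neg_of_hasLineDerivAt (v := ((0, Pi.single i 1) : PhaseSpace N))
      (hfC.mul hρc) (by fun_prop) hgC hg'C hgc hg'c
    · intro x
      have h1 := hasLineDerivAt_partialP hfd i x
      have h2 := P.hasLineDerivAt_gibbsDensity (T := T) (P.hasLineDerivAt_hamiltonian_unitP N x i)
      unfold HasLineDerivAt at h1 h2 ⊢
      have h := h1.fun_mul h2
      simp only [zero_smul, add_zero] at h
      exact h
    · exact fun x => hasLineDerivAt_partialP hgd i x
  -- integrability of the pieces (continuous, with the compactly supported factor `f` or `∂_p f`)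
  have hsq : HasCompactSupport fun x => partialP i f x ^ 2 :=
    hgc.comp_left (g := fun t : ℝ => t ^ 2) (by norm_num)
  have int1 : Integrable fun x => (partialP i f x) ^ 2 * P.gibbsDensity N T x :=
    ((hgC.pow 2).mul hρc).integrable_of_hasCompactSupport hsq.mul_right
  have int2 : Integrable fun x => x.2 i * (f x * partialP i f x) * P.gibbsDensity N T x := by
    refine Continuous.integrable_of_hasCompactSupport (by fun_prop) ?_
    exact (hfc.mul_right (f' := partialP i f)).mul_left.mul_right
  have int3 : Integrable fun x => (f x * P.gibbsDensity N T x) * partialP i (partialP i f) x := by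
    refine Continuous.integrable_of_hasCompactSupport (by fun_prop) ?_
    exact (hfc.mul_right (f' := P.gibbsDensity N T)).mul_right
  have e' : ∫ x, (f x * P.gibbsDensity N T x) * partialP i (partialP i f) x =
      (-∫ x, (partialP i f x) ^ 2 * P.gibbsDensity N T x) +
        T⁻¹ * ∫ x, x.2 i * (f x * partialP i f x) * P.gibbsDensity N T x := by
    rw [e]
    have h : (fun x => (partialP i f x * P.gibbsDensity N T x +
        f x * (-(x.2 i / T) * P.gibbsDensity N T x)) * partialP i f x) =
        fun x => (partialP i f x) ^ 2 * P.gibbsDensity N T x -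
          T⁻¹ * (x.2 i * (f x * partialP i f x) * P.gibbsDensity N T x) := by
      funext x; ring
    rw [h, integral_sub int1 (int2.const_mul _), integral_const_mul]
    ring
  have hsplit : (fun x => f x * (T * partialP i (partialP i f) x - x.2 i * partialP i f x) *
      P.gibbsDensity N T x) = fun x => T * ((f x * P.gibbsDensity N T x) *
        partialP i (partialP i f) x) - x.2 i * (f x * partialP i f x) * P.gibbsDensity N T x := by
    funext x; ring
  rw [hsplit, integral_sub (int3.const_mul T) int2, integral_const_mul, e', mul_add, ← mul_assoc,
    mul_inv_cancel₀ hT, one_mul]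
  ring

/-- **Dirichlet form of the equilibrium generator against `e^{-H/T}`** (density level). For `C¹`
potentials, `T ≠ 0` and `f ∈ C²_c`, with `L = L_{T,T}` the generator with both baths at `T`:
`∫ f (L f) e^{-H/T} dq dp = -γ T ∑_i (1[i=0] + 1[i=N-1]) ∫ (∂_{p_i} f)² e^{-H/T} dq dp`
(the Liouville part drops out by antisymmetry, each bath contributes `-γT ∫ (∂_{p_b} f)² ρ`; for
`N = 1` both baths sit on the single site, which is counted twice, as in `OscillatorChain.generator`).
[Cuneo–Eckmann–Hairer–Rey-Bellet 2018, §3.1, proof of Prop. 3.3] [folklore] -/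
theorem integral_mul_generator_mul_gibbsDensity (P : OscillatorChain) (hU : ContDiff ℝ 1 P.U)
    (hV : ContDiff ℝ 1 P.V) (N : ℕ) {T : ℝ} (hT : T ≠ 0) {f : PhaseSpace N → ℝ}
    (hf : ContDiff ℝ 2 f) (hfc : HasCompactSupport f) :
    ∫ x, f x * P.generator N T T f x * P.gibbsDensity N T x =
      -(P.γ * T) * ∑ i : Fin N, ((if i.val = 0 then (1 : ℝ) else 0) +
        (if i.val = N - 1 then (1 : ℝ) else 0)) * ∫ x, (partialP i f x) ^ 2 * P.gibbsDensity N T x := by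
  have hf1 : ContDiff ℝ 1 f := hf.of_le (by norm_num)
  have hH1 : ContDiff ℝ 1 (P.hamiltonian N) := P.contDiff_hamiltonian hU hV N
  have hρc : Continuous (P.gibbsDensity N T) :=
    P.continuous_gibbsDensity hU.continuous hV.continuous N T
  have hfC : Continuous f := hf.continuous
  have hQc : ∀ i, Continuous (partialQ i f) := fun i => continuous_partialQ hf1 one_ne_zero i
  have hPc : ∀ i, Continuous (partialP i f) := fun i => continuous_partialP hf1 one_ne_zero i
  have hP1 : ∀ i, ContDiff ℝ 1 (partialP i f) := fun i => contDiff_partialP hf (by norm_num) i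
  have hPPc : ∀ i, Continuous (partialP i (partialP i f)) := fun i =>
    continuous_partialP (hP1 i) one_ne_zero i
  have hWc : ∀ i, Continuous (partialQ i (P.hamiltonian N)) := fun i =>
    P.continuous_partialQ_hamiltonian hH1 i
  -- integrability: every integrand is continuous with the compactly supported factor `f`
  have intA : ∀ i, Integrable (fun x => f x * (x.2 i * partialQ i f x -
      partialQ i (P.hamiltonian N) x * partialP i f x) * P.gibbsDensity N T x) := fun i =>
    Continuous.integrable_of_hasCompactSupport (by fun_prop) (hfc.mul_right.mul_right)
  have intB : ∀ (i : Fin N) (c : Prop) [Decidable c], Integrable (fun x =>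
      f x * (if c then T * partialP i (partialP i f) x - x.2 i * partialP i f x else 0) *
        P.gibbsDensity N T x) := by
    intro i c _
    by_cases hc : c
    · simp only [hc, if_true]
      exact Continuous.integrable_of_hasCompactSupport (by fun_prop) (hfc.mul_right.mul_right)
    · simp only [hc, if_false, mul_zero, zero_mul]
      exact integrable_zero _ _ _
  have intBC : ∀ i : Fin N, Integrable (fun x =>
      f x * (if i.val = 0 then T * partialP i (partialP i f) x - x.2 i * partialP i f x
          else 0) * P.gibbsDensity N T x +
        f x * (if i.val = N - 1 then T * partialP i (partialP i f) x - x.2 i * partialP i f x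
          else 0) * P.gibbsDensity N T x) :=
    fun i => (intB i _).add (intB i _)
  -- the value of each bath term
  have valB : ∀ (i : Fin N) (c : Prop) [Decidable c], ∫ x,
      f x * (if c then T * partialP i (partialP i f) x - x.2 i * partialP i f x else 0) *
        P.gibbsDensity N T x =
      (if c then (1 : ℝ) else 0) * (-T * ∫ x, (partialP i f x) ^ 2 * P.gibbsDensity N T x) := by
    intro i c _
    by_cases hc : c
    · simp only [hc, if_true, one_mul]
      exact integral_mul_bath_mul_gibbsDensity P hU hV N hT hf hfc i
    · simp only [hc, if_false, mul_zero, zero_mul, integral_zero]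
  -- pointwise splitting of the integrand along the structure of the generator
  have hsplit : (fun x => f x * P.generator N T T f x * P.gibbsDensity N T x) = fun x =>
      (∑ i : Fin N, f x * (x.2 i * partialQ i f x -
        partialQ i (P.hamiltonian N) x * partialP i f x) * P.gibbsDensity N T x) +
      P.γ * ∑ i : Fin N,
        (f x * (if i.val = 0 then T * partialP i (partialP i f) x - x.2 i * partialP i f x
            else 0) * P.gibbsDensity N T x +
          f x * (if i.val = N - 1 then T * partialP i (partialP i f) x - x.2 i * partialP i f x
            else 0) * P.gibbsDensity N T x) := by
    funext x
    rw [OscillatorChain.generator]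
    rw [show ∀ (a S S' : ℝ), f x * (S + a * S') * P.gibbsDensity N T x =
        (f x * P.gibbsDensity N T x) * S + a * ((f x * P.gibbsDensity N T x) * S')
        from fun a S S' => by ring, Finset.mul_sum, Finset.mul_sum]
    congr 1
    · exact Finset.sum_congr rfl fun i _ => by ring
    · congr 1
      exact Finset.sum_congr rfl fun i _ => by ring
  rw [hsplit, integral_add (integrable_finsetSum _ fun i _ => intA i)
      ((integrable_finsetSum _ fun i _ => intBC i).const_mul _),
    integral_const_mul, integral_finsetSum _ fun i _ => intA i,
    integral_finsetSum _ fun i _ => intBC i,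
    Finset.sum_eq_zero fun i _ => integral_mul_liouville_mul_gibbsDensity P hU hV N T hf1 hfc i,
    zero_add, Finset.mul_sum, Finset.mul_sum]
  refine Finset.sum_congr rfl fun i _ => ?_
  rw [integral_add (intB i _) (intB i _), valB, valB]
  ring

/-- **Dirichlet form of the equilibrium generator in the Gibbs state** (measure level). For `C¹`
potentials, `T ≠ 0` and `f ∈ C²_c`:
`∫ f (L_{T,T} f) dμ_T = -γ T ∑_i (1[i=0] + 1[i=N-1]) ∫ (∂_{p_i} f)² dμ_T`,
`μ_T = Z⁻¹ e^{-H/T} dq dp` (from the density-level identity and `integral_gibbsMeasure`; both sides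
vanish if `e^{-H/T}` is not integrable). In operator language: `L_{T,T} = A - γT ∑_b ∂_{p_b}^* ∂_{p_b}`
on `C_c^∞ ⊂ L²(μ_T)` with `A` antisymmetric. [Cuneo–Eckmann–Hairer–Rey-Bellet 2018, §3.1, proof of
Prop. 3.3] [folklore] -/
theorem integral_mul_generator_gibbsMeasure (P : OscillatorChain) (hU : ContDiff ℝ 1 P.U)
    (hV : ContDiff ℝ 1 P.V) (N : ℕ) {T : ℝ} (hT : T ≠ 0) {f : PhaseSpace N → ℝ}
    (hf : ContDiff ℝ 2 f) (hfc : HasCompactSupport f) :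
    ∫ x, f x * P.generator N T T f x ∂(P.gibbsMeasure N T) =
      -(P.γ * T) * ∑ i : Fin N, ((if i.val = 0 then (1 : ℝ) else 0) +
        (if i.val = N - 1 then (1 : ℝ) else 0)) *
          ∫ x, (partialP i f x) ^ 2 ∂(P.gibbsMeasure N T) := by
  simp only [P.integral_gibbsMeasure]
  rw [integral_mul_generator_mul_gibbsDensity P hU hV N hT hf hfc, Finset.mul_sum, Finset.mul_sum,
    Finset.mul_sum]
  exact Finset.sum_congr rfl fun i _ => by ring

/-! ### The registered stub -/

/-- **S3a `stub_gibbsContactCalculus`: the static contact calculus of the equilibrium Gibbs state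
of the pinned chain** (`ω₂, lam, β, γ > 0`, `T > 0`, `N ≥ 1`). With `P = pinnedChain ω₂ lam β γ`,
`μ_T = P.gibbsMeasure N T` and `L = P.generator N T T` (both baths at `T`), for every test
function `f ∈ C_c^∞`:

* (a) DIRICHLET FORM: `∫ f (L f) dμ_T = -(γT) ∑_i (1[i=0] + 1[i=N-1]) ∫ (∂_{p_i} f)² dμ_T` — the
  `L²(μ_T)` quadratic form of the equilibrium generator is minus the Ornstein–Uhlenbeck Dirichlet
  form of the two contact momenta (for `N = 1` the single site carries both baths);
* (b) GAUSSIAN INTEGRATION BY PARTS: `∫ (p_i² - T) f dμ_T = T ∫ p_i ∂_{p_i} f dμ_T` for every `i`.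

Proof. (a) Write `L f = ∑_i (p_i ∂_{q_i} f - ∂_{q_i}H ∂_{p_i} f) + γ ∑_b (T ∂²_{p_b} f - p_b ∂_{p_b} f)`
(`b ∈ {0, N-1}`). Against `f e^{-H/T}` the Liouville part integrates to zero
(`integral_mul_liouville_mul_gibbsDensity`: `∫ X_H(f²) e^{-H/T} = 0` by the tree's
`integral_liouville_mul_gibbsDensity` and `X_H(f²) = 2 f X_H f`), and each bath term gives
`-T ∫ (∂_{p_b} f)² e^{-H/T}` by one integration by parts in `p_b` using
`∂_{p_b} e^{-H/T} = -(p_b/T) e^{-H/T}` (`integral_mul_bath_mul_gibbsDensity`); divide by `∫ e^{-H/T}`.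
(b) Integrate by parts in `p_i`: `∫ p_i e^{-H/T} ∂_{p_i} f = -∫ ∂_{p_i}(p_i e^{-H/T}) f
= -∫ (1 - p_i²/T) e^{-H/T} f` (`integral_sq_sub_mul_mul_gibbsDensity`). Both are the pointwise-in-time
content of the Clausius budget of the line. [cite: CuneoEckmannHairerReyBellet2018, §3.1, proof of Prop. 3.3] -/
theorem stub_gibbsContactCalculus :
    ∀ ω₂ lam β γ : ℝ, 0 < ω₂ → 0 < lam → 0 < β → 0 < γ → ∀ T : ℝ, 0 < T → ∀ N : ℕ, 0 < N →
      ∀ f : PhaseSpace N → ℝ, ContDiff ℝ (⊤ : ℕ∞) f → HasCompactSupport f →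
        (∫ x, f x * (pinnedChain ω₂ lam β γ).generator N T T f x ∂((pinnedChain ω₂ lam β γ).gibbsMeasure N T) =
          -(γ * T) * ∑ i : Fin N, ((if i.val = 0 then (1 : ℝ) else 0) + (if i.val = N - 1 then (1 : ℝ) else 0)) *
            ∫ x, (partialP i f x) ^ 2 ∂((pinnedChain ω₂ lam β γ).gibbsMeasure N T)) ∧
        (∀ i : Fin N, ∫ x, (x.2 i ^ 2 - T) * f x ∂((pinnedChain ω₂ lam β γ).gibbsMeasure N T) =
          T * ∫ x, x.2 i * partialP i f x ∂((pinnedChain ω₂ lam β γ).gibbsMeasure N T)) := by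
  intro ω₂ lam β γ _hω _hl _hβ _hγ T hT N _hN f hf hfc
  have hT0 : T ≠ 0 := hT.ne'
  have hf2 : ContDiff ℝ 2 f := hf.of_le (by norm_cast)
  have hf1 : ContDiff ℝ 1 f := hf.of_le (by norm_cast)
  have hU : ContDiff ℝ 1 (pinnedChain ω₂ lam β γ).U := pinnedChain_contDiff_U ω₂ lam β γ
  have hV : ContDiff ℝ 1 (pinnedChain ω₂ lam β γ).V := pinnedChain_contDiff_V ω₂ lam β γ
  refine ⟨?_, fun i =>
    integral_sq_sub_mul_gibbsMeasure _ hU.continuous hV.continuous N hT0 hf1 hfc i⟩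
  have hγ' : (pinnedChain ω₂ lam β γ).γ = γ := rfl
  rw [integral_mul_generator_gibbsMeasure _ hU hV N hT0 hf2 hfc, hγ']

end Summit.AtomisticToContinuum.FouriersLaw.Theorems.ExtensiveSnapshotIrreversibility.ClausiusBudget

end
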